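import Summits.CriticalPhenomena.CardyFormulaZ2.Theorems.CardyIKTransportIKLinearTransportStubCoalescingRowKernelReduction

/-!
# Stub `stub_CutMarkovLocal` (Loc) — part C: TWO-SIDED ENVIRONMENT-LOCALITY of a row kernel, and the sweeps of
# its heat bath in two environments agreeing between two cut rows

Support file (`--supports stmt-CriticalPhenomena-5076`, registered sub-goal `crk_sweep_agree_env`).

THE HYPOTHESIS the locality (Loc) of the cut-Markov heat bath really needs, and which the cut-Markov structure
`CutMarkovKernel S i k` (`…StubCoalescingRowKernelIdentity.lean`) does not record: the field `reads` makes the kernel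
`k (p, z)` local in the PAST `z` (it reads `z` only above a cut row of `p` below row `0`), but says nothing about its
dependence on the ENVIRONMENT `p = (e, Δ)` — the off-middle observables `e` and the strip diagram `Δ` are global
objects, and a version of the conditional row law may read them anywhere. `ReadsEnv i k` is the two-sided analogue
of `reads` for the environment: between a cut row `c ≤ -1` and a cut row `c' ≥ 1` present in BOTH environments, the
kernel reads the environment only on the strip cells/faces (cell columns `i, i+1, i+2`) of the rows `[c-2, c'+2]` and
the diagram only on the pairs of boundary cells with both rows in `[c-2, c'+2]` (`EnvAgree`). (Why a version with
this property exists: on the event of the two cuts the conditional law of the middle row `0` of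
`νmix (S ∆ {i,i+1})` given the row statistic factorises across both cuts — forced middle colours, bichromatic face
rows, rerouting of the strip paths, Markov property of the middle column given the boundary columns — so it is the
law of row `0` of the FINITE diagram-conditioned chain between the cuts, a function of exactly these data.)

THE CONSEQUENCE proved here (`crk_sweep_agree_env`, registered): for a cut-Markov kernel with `ReadsEnv`, the
heat-bath sweeps `rowSweep (rowDyn i crkU (crkG S i k))` run with the same fresh bits in two environments `p, p'`
which both have cut rows `c₁ < c'₁` and agree between them (`EnvAgree i (c₁-2) (c'₁+2) p p'`), started anywhere at
or below row `c₁+1` from ANY two starts, produce the same middle rows `c₁+1, …` as long as they stay below `c'₁`: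
row by row, two starts are absorbed one row after the cut (`crk_step_agree`, field `reads`), and the two
environments give the same kernel value (`ReadsEnv`, transported along the vertical shift of the row map), hence
the same sampled row (`crkQ_congr`). Also: the sweeps read the fresh bits only at the middle cells of the rows they
visit (`crk_sweep_rd`).
-/

noncomputable section

namespace Summit.CriticalPhenomena.CardyFormulaZ2.Theorems.IKLinearTransport.PinnedDiagramExchange

open scoped Classical MeasureTheory ENNReal symmDiff
open Set MeasureTheory
open Literature.Probability.Percolation Literature.Probability.LatticeModels

/-! ## Environment agreement and two-sided environment-locality -/

/-- AGREEMENT OF TWO ENVIRONMENTS on the strip rows `[lo, hi]`: the off-middle observables agree on the strip cells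
and faces (columns `i, i+1, i+2`) of these rows, the diagrams on the pairs with both rows in `[lo, hi]`. [folklore] -/
def EnvAgree (i lo hi : ℤ) (p p' : Obs × Set (Site 2 × Site 2)) : Prop :=
  (∀ w : Site 2, i ≤ w 0 → w 0 ≤ i + 2 → lo ≤ w 1 → w 1 ≤ hi →
    (w ∈ p.1.1 ↔ w ∈ p'.1.1) ∧ (w ∈ p.1.2 ↔ w ∈ p'.1.2)) ∧
  (∀ q : Site 2 × Site 2, lo ≤ q.1 1 → q.1 1 ≤ hi → lo ≤ q.2 1 → q.2 1 ≤ hi → (q ∈ p.2 ↔ q ∈ p'.2))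

/-- TWO-SIDED ENVIRONMENT-LOCALITY of a row kernel (`ReadsEnv i k`, the hypothesis (Loc) needs on the version):
between a cut row `c ≤ -1` and a cut row `c' ≥ 1` present in both environments, `k (·, z)` reads the environment
only on the strip rows `[c-2, c'+2]`. A statement the line POSITS of the version (with `CutMarkovKernel`). [folklore] -/
def ReadsEnv (i : ℤ) (k : (Obs × Set (Site 2 × Site 2)) × Obs → Bool × Bool × Bool → ℝ) : Prop :=
  ∀ (p p' : Obs × Set (Site 2 × Site 2)) (z : Obs) (c c' : ℤ), c ≤ -1 → 1 ≤ c' →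
    IsCut i c p → IsCut i c' p → IsCut i c p' → IsCut i c' p' → EnvAgree i (c - 2) (c' + 2) p p' →
    k (p, z) = k (p', z)

/-- `EnvAgree` is symmetric. [folklore] -/
theorem envAgree_symm {i lo hi : ℤ} {p p' : Obs × Set (Site 2 × Site 2)} (h : EnvAgree i lo hi p p') :
    EnvAgree i lo hi p' p :=
  ⟨fun w a b c d => ⟨((h.1 w a b c d).1).symm, ((h.1 w a b c d).2).symm⟩, fun q a b c d => (h.2 q a b c d).symm⟩

/-- `EnvAgree` is monotone in the row range. [folklore] -/
theorem envAgree_mono {i lo hi lo' hi' : ℤ} {p p' : Obs × Set (Site 2 × Site 2)} (h : EnvAgree i lo hi p p')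
    (hlo : lo ≤ lo') (hhi : hi' ≤ hi) : EnvAgree i lo' hi' p p' :=
  ⟨fun w a b c d => h.1 w a b (by omega) (by omega), fun q a b c d => h.2 q (by omega) (by omega) (by omega) (by omega)⟩

/-- `EnvAgree` is transported by the vertical shift of the environment space. [folklore] -/
theorem envAgree_pshift {i lo hi : ℤ} {p p' : Obs × Set (Site 2 × Site 2)} (h : EnvAgree i lo hi p p') (m : ℤ) :
    EnvAgree i (lo + m) (hi + m) (pshift m p) (pshift m p') := by
  refine ⟨fun w a b c d => ?_, fun q a b c d => ?_⟩
  · have e := ps2_sub_vec_apply w m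
    have := h.1 (w - ![0, m]) (by rw [e.1]; exact a) (by rw [e.1]; exact b) (by rw [e.2]; omega) (by rw [e.2]; omega)
    exact this
  · have e1 := ps2_sub_vec_apply q.1 m
    have e2 := ps2_sub_vec_apply q.2 m
    have := h.2 (q.1 - ![0, m], q.2 - ![0, m]) (by simp only [e1.2]; omega) (by simp only [e1.2]; omega)
      (by simp only [e2.2]; omega) (by simp only [e2.2]; omega)
    exact this

/-! ## The kernel value in two environments -/

section Kernel

variable (S : Set ℤ) (i : ℤ) (k : (Obs × Set (Site 2 × Site 2)) × Obs → Bool × Bool × Bool → ℝ)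

/-- Between two cut rows `c₁ < y < c'₁` present in both environments and with agreement on the strip rows
`[c₁-2, c'₁+2]`, the back-shifted kernel values at row `y` agree. [folklore] -/
theorem crk_kernel_env_congr (hke : ReadsEnv i k) (p p' : Obs × Set (Site 2 × Site 2)) (c₁ c'₁ y : ℤ)
    (hc : c₁ ≤ y - 1) (hc' : y + 1 ≤ c'₁) (h1 : IsCut i c₁ p) (h2 : IsCut i c'₁ p) (h3 : IsCut i c₁ p')
    (h4 : IsCut i c'₁ p') (hag : EnvAgree i (c₁ - 2) (c'₁ + 2) p p') (z : Obs) :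
    k (pshift (-y) p, z) = k (pshift (-y) p', z) := by
  refine hke (pshift (-y) p) (pshift (-y) p') z (c₁ - y) (c'₁ - y) (by omega) (by omega) ?_ ?_ ?_ ?_ ?_
  · rw [isCut_pshift, show c₁ - y - -y = c₁ by ring]; exact h1
  · rw [isCut_pshift, show c'₁ - y - -y = c'₁ by ring]; exact h2
  · rw [isCut_pshift, show c₁ - y - -y = c₁ by ring]; exact h3
  · rw [isCut_pshift, show c'₁ - y - -y = c'₁ by ring]; exact h4
  · have := envAgree_pshift hag (-y)
    rw [show c₁ - 2 + -y = c₁ - y - 2 by ring, show c'₁ + 2 + -y = c'₁ - y + 2 by ring] at this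
    exact this

/-- The row map of the reduction in two environments giving the same kernel value is the same map. [folklore] -/
theorem crk_rowDyn_env_congr (y : ℤ) (p p' : Obs × Set (Site 2 × Site 2)) (u : Rnd) (A : Obs)
    (h : k (pshift (-y) p, pastMid i 0 (vshift (-y) A)) = k (pshift (-y) p', pastMid i 0 (vshift (-y) A))) :
    rowDyn i crkU (crkG S i k) y p u A = rowDyn i crkU (crkG S i k) y p' u A := by
  rw [crk_rowDyn_eq, crk_rowDyn_eq, crkQ_congr k h]

/-- `MidAgree` is transitive. [folklore] -/
theorem midAgree_trans {i lo hi : ℤ} {z₁ z₂ z₃ : Obs} (h : MidAgree i lo hi z₁ z₂) (h' : MidAgree i lo hi z₂ z₃) :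
    MidAgree i lo hi z₁ z₃ := fun w a b =>
  ⟨fun c => ((h w a b).1 c).trans ((h' w a b).1 c), fun c => ((h w a b).2 c).trans ((h' w a b).2 c)⟩

/-- THE SWEEPS IN TWO ENVIRONMENTS AGREE BETWEEN TWO CUT ROWS (registered sub-goal `crk_sweep_agree_env`): for a
cut-Markov kernel with two-sided environment-locality, two environments having cut rows `c₁ < c'₁` and agreeing on
the strip rows `[c₁-2, c'₁+2]`, the same fresh bits, any two starts and a sweep started at or below row `c₁+1`, the
middle rows `c₁+1, …, a+n-1` of the two sweeps coincide as long as `a + n ≤ c'₁`. [folklore] -/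
theorem crk_sweep_agree_env (hk : CutMarkovKernel S i k) (hke : ReadsEnv i k) (c₁ c'₁ a : ℤ) (hca : a ≤ c₁ + 1)
    (p p' : Obs × Set (Site 2 × Site 2)) (h1 : IsCut i c₁ p) (h2 : IsCut i c'₁ p) (h3 : IsCut i c₁ p')
    (h4 : IsCut i c'₁ p') (hag : EnvAgree i (c₁ - 2) (c'₁ + 2) p p') (u : Rnd) (z z' : Obs) :
    ∀ n : ℕ, a + n ≤ c'₁ → MidAgree i (c₁ + 1) (a + n) (rowSweep (rowDyn i crkU (crkG S i k)) n a p u z)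
      (rowSweep (rowDyn i crkU (crkG S i k)) n a p' u z')
  | 0 => fun _ w hw1 hw2 => by push_cast at hw2; omega
  | n + 1 => by
    intro hn
    have hn' : a + n ≤ c'₁ := by push_cast at hn; omega
    have ih := crk_sweep_agree_env hk hke c₁ c'₁ a hca p p' h1 h2 h3 h4 hag u z z' n hn'
    rw [crk_rowSweep_succ, crk_rowSweep_succ, show a + ((n + 1 : ℕ) : ℤ) = (a + n) + 1 by push_cast; ring]
    set A := rowSweep (rowDyn i crkU (crkG S i k)) n a p u z
    set A' := rowSweep (rowDyn i crkU (crkG S i k)) n a p' u z'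
    by_cases hcn : c₁ + 1 ≤ a + n
    · -- the two starts are absorbed (same environment), then the two environments give the same row map
      have step1 := crk_step_agree S i k hk c₁ (a + n) hcn p h1 u A A' ih
      have hval := crk_kernel_env_congr i k hke p p' c₁ c'₁ (a + n) (by omega) (by push_cast at hn; omega) h1 h2 h3 h4
        hag (pastMid i 0 (vshift (-(a + n)) A'))
      rw [← crk_rowDyn_env_congr S i k (a + n) p p' u A' hval]
      exact step1
    · intro w hw1 hw2; omega

end Kernel

/-! ## The sweeps read the fresh bits only at the middle cells of their rows -/

section Bits

variable (S : Set ℤ) (i : ℤ) (k : (Obs × Set (Site 2 × Site 2)) × Obs → Bool × Bool × Bool → ℝ)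

/-- The row map at `y` reads the fresh bits only at the cell `(i+1, y)`. [folklore] -/
theorem crk_rowDyn_rd_cell (y : ℤ) (p : Obs × Set (Site 2 × Site 2)) (z : Obs) (u u' : Rnd)
    (h : ∀ kk : ℕ, (((![i + 1, y] : Site 2), kk) ∈ u ↔ ((![i + 1, y] : Site 2), kk) ∈ u')) :
    rowDyn i crkU (crkG S i k) y p u z = rowDyn i crkU (crkG S i k) y p u' z := by
  have key : crkU ![i + 1, 0] (ushift (-y) u) = crkU ![i + 1, 0] (ushift (-y) u') := by
    rw [crkU_spec.2.2.1, crkU_spec.2.2.1, crk_vec_sub, show (0 : ℤ) - -y = y by ring]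
    exact crkU_spec.2.1 _ u u' h
  unfold rowDyn
  rw [key]

/-- A sweep reads the fresh bits only at the middle cells `(i+1, y)` of the rows `a ≤ y < a+n` it visits. [folklore] -/
theorem crk_sweep_rd (a : ℤ) (p : Obs × Set (Site 2 × Site 2)) (z : Obs) (u u' : Rnd) :
    ∀ n : ℕ, (∀ y : ℤ, a ≤ y → y < a + n → ∀ kk : ℕ, (((![i + 1, y] : Site 2), kk) ∈ u ↔ ((![i + 1, y] : Site 2), kk) ∈ u')) →
      rowSweep (rowDyn i crkU (crkG S i k)) n a p u z = rowSweep (rowDyn i crkU (crkG S i k)) n a p u' z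
  | 0 => fun _ => rfl
  | n + 1 => by
    intro h
    rw [crk_rowSweep_succ, crk_rowSweep_succ,
      crk_sweep_rd a p z u u' n fun y hy1 hy2 => h y hy1 (by push_cast; omega),
      crk_rowDyn_rd_cell S i k (a + n) p _ u u' (h (a + n) (by omega) (by push_cast; omega))]

/-- A sweep rewrites only the middle data of the rows it visits (`ps2_sweep_offRows` for `rowSweep`). [folklore] -/
theorem crk_sweep_offRows (n : ℕ) (a : ℤ) (p : Obs × Set (Site 2 × Site 2)) (u : Rnd) (z : Obs) (w : Site 2) :
    (¬ (w 0 = i + 1 ∧ a ≤ w 1 ∧ w 1 < a + n) → (w ∈ (rowSweep (rowDyn i crkU (crkG S i k)) n a p u z).1 ↔ w ∈ z.1)) ∧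
    (¬ ((w 0 = i ∨ w 0 = i + 1) ∧ a ≤ w 1 ∧ w 1 < a + n) →
      (w ∈ (rowSweep (rowDyn i crkU (crkG S i k)) n a p u z).2 ↔ w ∈ z.2)) :=
  ps2_sweep_offRows (T := rowSweep (rowDyn i crkU (crkG S i k))) (fun _ _ _ _ _ => rfl)
    (rowDyn_writes i crkU (crkG S i k)) n a p u z w

end Bits

/-! ## The registered form -/

/-- THE SWEEPS IN TWO ENVIRONMENTS AGREE BETWEEN TWO CUT ROWS (registered sub-goal `sweep_agree_env`): for a
cut-Markov kernel `k` with two-sided environment-locality `ReadsEnv i k`, two environments with cut rows `c₁ < c'₁`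
agreeing on the strip rows `[c₁-2, c'₁+2]`, the same fresh bits and ANY two starts, the sweeps of the heat bath
`rowDyn i crkU (crkG S i k)` started at a row `a ≤ c₁+1` produce the same middle rows `c₁+1, …, a+n-1` whenever
`a + n ≤ c'₁`. [folklore] -/
theorem sweep_agree_env : ∀ (S : Set ℤ) (i : ℤ) (k : (Obs × Set (Site 2 × Site 2)) × Obs → Bool × Bool × Bool → ℝ),
    CutMarkovKernel S i k → ReadsEnv i k → ∀ (c₁ c'₁ a : ℤ), a ≤ c₁ + 1 → ∀ (p p' : Obs × Set (Site 2 × Site 2)),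
    IsCut i c₁ p → IsCut i c'₁ p → IsCut i c₁ p' → IsCut i c'₁ p' → EnvAgree i (c₁ - 2) (c'₁ + 2) p p' →
    ∀ (u : Rnd) (z z' : Obs) (n : ℕ), a + n ≤ c'₁ →
    MidAgree i (c₁ + 1) (a + n) (rowSweep (rowDyn i crkU (crkG S i k)) n a p u z)
      (rowSweep (rowDyn i crkU (crkG S i k)) n a p' u z') :=
  fun S i k hk hke c₁ c'₁ a hca p p' h1 h2 h3 h4 hag u z z' n hn =>
    crk_sweep_agree_env S i k hk hke c₁ c'₁ a hca p p' h1 h2 h3 h4 hag u z z' n hn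

end Summit.CriticalPhenomena.CardyFormulaZ2.Theorems.IKLinearTransport.PinnedDiagramExchange
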